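import Mathlib
import Literature.NumberTheory.EllipticCurves.IwasawaAlgebraGenericTwistFiniteProofs
import Literature.NumberTheory.EllipticCurves.IwasawaAlgebraFiniteCokernelRigidityProofs

/-!
# STUB-IDEAS k2 g30 — `stub_heegnerIndexLowerAtTwo` (crux `SplitBadTwoLowerHalfOfFacts`, route PrintCf2)

Sketch for the idea card `Ideas/stub-heegnerindexloweratwo-k2-g30.md`
(technique: literature transfer with a typed dictionary — Hilbert 90 / Serre *Local Fields* V §3 /
de Shalit I.3.8 (17) / Nekovář 8.4.8 ↦ the INTEGRAL structure of the Iwasawa `H¹` at `v` on the strict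
unramified `ℤ₂`-line, for the six split-bad keys `u ∈ {-1, 3, 2, -2, 6, -6}`).

Contents (all `sorry`-free):
* §1 `dual_existsUnique_of_coprimePair` — pure algebra: a functional on a submodule `N ↪ R` of a domain
  containing a "coprime pair" is a multiple of the inclusion (the algebraic kernel of R177 / N2′ ×6).
* §2 `ideal_dual_existsUnique`, `ideal_dual_generator_bijective` — instantiation over `Λ = ℤ₂⟦T⟧`
  (`Literature.NumberTheory.EllipticCurves.IwasawaAlgebra 2`) for ANY ideal containing `p^k` and `T - c`
  (`c ∈ 𝔪_{ℤ_p}`): covers `Λ` itself, `𝔪 = (2,T)`, and every `I_v ⊇ J_v = (2^{a(u)}, γ_v - b′)`.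
* §3 the typed dictionary of the six keys as DECIDABLE tables: Artin–Schreier class `ē(u)` of the norm torus
  (computed in the exact model `ℤ[√u]`, `4𝒪 = {v_L ≥ 4}`), `[√u ∈ 𝒪_L^×]`, conductor exponent `n(u)`, lower
  break `s(u)`, de Shalit cokernel length `a(u)`, torsion exponents, dual divisibility `j(u)`, module colength `c(u)`,
  layer-0 index `j + c`, and descent cokernel.
* §4 `Prop` signatures of the two module-theoretic helper lemmas the typer needs (H-EXT, H-COL).

Nothing here asserts anything about elliptic curves; BSD is NOT proved by any of this.
-/

namespace Summit.BirchSwinnertonDyer.BirchSwinnertonDyer.Cruxes.SplitBadTwoLowerHalfOfFacts.InertiaDescentK2G30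

/-! ### §1 The coprime-pair lemma: `Hom_R(N, R) = R · ι` -/

section CoprimePair

variable {R : Type*} [CommRing R] [IsDomain R] {N : Type*} [AddCommGroup N] [Module R N]

/-- Proportionality inside a submodule of `R`: `ι(x)·y = ι(y)·x` (apply the injective `ι`). -/
theorem smul_eq_smul_of_injective (ι : N →ₗ[R] R) (hι : Function.Injective ι) (x y : N) :
    ι x • y = ι y • x := by
  apply hι
  simp only [map_smul, smul_eq_mul, mul_comm]

/-- Any functional `f` is proportional to `ι`: `ι(x)·f(y) = ι(y)·f(x)`. -/
theorem apply_mul_apply_comm (ι : N →ₗ[R] R) (hι : Function.Injective ι) (f : N →ₗ[R] R)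
    (x y : N) : ι x * f y = ι y * f x := by
  have h := congrArg f (smul_eq_smul_of_injective ι hι x y)
  simpa only [map_smul, smul_eq_mul] using h

/-- **Coprime-pair lemma.** If `N ↪ R` contains `a, b` with `ι a ≠ 0` and `ι a ∣ ι b · y → ι a ∣ y`
for all `y`, then every `R`-linear `f : N → R` is `r · ι` for a UNIQUE `r ∈ R`.
(Algebraic kernel of N2′: `Hom_Λ(M_v, Λ_v)` is free of rank one, generated by the inclusion.) -/
theorem dual_existsUnique_of_coprimePair (ι : N →ₗ[R] R) (hι : Function.Injective ι) {a b : N}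
    (ha : ι a ≠ 0) (hcop : ∀ y : R, ι a ∣ ι b * y → ι a ∣ y) (f : N →ₗ[R] R) :
    ∃! r : R, ∀ x, f x = r * ι x := by
  have h1 : ι a * f b = ι b * f a := apply_mul_apply_comm ι hι f a b
  have hdvd : ι a ∣ f a := hcop (f a) ⟨f b, by rw [← h1]⟩
  obtain ⟨r, hr⟩ := hdvd
  refine ⟨r, fun x => ?_, fun r' hr' => ?_⟩
  · have h2 : ι a * f x = ι x * f a := apply_mul_apply_comm ι hι f a x
    have h3 : ι a * f x = ι a * (r * ι x) := by rw [h2, hr]; ring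
    exact mul_left_cancel₀ ha h3
  · have h4 := hr' a
    have h5 : ι a * r' = ι a * r := by
      calc ι a * r' = r' * ι a := mul_comm _ _
        _ = f a := h4.symm
        _ = ι a * r := hr
    exact mul_left_cancel₀ ha h5

end CoprimePair

/-! ### §2 Instantiation over `Λ = ℤ_p⟦T⟧`: ideals containing `p^k` and `T - c` have free dual -/

section Iwasawa

open PowerSeries Literature.NumberTheory.EllipticCurves

variable (p : ℕ) [Fact p.Prime]

/-- `T - c ∣ p^k · y ⟹ T - c ∣ y` (`T - c` is prime and divides no non-zero constant). -/
theorem X_sub_C_dvd_of_dvd_natCast_pow_mul {c : ℤ_[p]} (hc : c ∈ IsLocalRing.maximalIdeal ℤ_[p])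
    (k : ℕ) (y : IwasawaAlgebra p)
    (h : (X - C c : IwasawaAlgebra p) ∣ (p : IwasawaAlgebra p) ^ k * y) :
    (X - C c : IwasawaAlgebra p) ∣ y := by
  rcases (IwasawaAlgebra.prime_X_sub_C p hc).dvd_or_dvd h with h1 | h1
  · exfalso
    have e : ((p : IwasawaAlgebra p) ^ k) = C ((p : ℤ_[p]) ^ k) := by
      rw [map_pow, map_natCast]
    rw [e] at h1
    have h0 := IwasawaAlgebra.eq_zero_of_X_sub_C_dvd_C p hc h1
    exact pow_ne_zero k (Nat.cast_ne_zero.mpr (Fact.out : p.Prime).ne_zero) h0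
  · exact h1

/-- **Free dual of a "coprime-pair" ideal.** For an ideal `𝔟 ≤ Λ` containing `T - c` (`c ∈ 𝔪_{ℤ_p}`) and
`p^k`, every `Λ`-linear `f : 𝔟 → Λ` is `x ↦ r·x` for a unique `r`.  Cases used on the card:
`𝔟 = Λ` (free module), `𝔟 = 𝔪 = (p, T)` (`c = 0`, `k = 1`), `𝔟 = I_v ⊇ (2^{a(u)}, T - (b′-1))`. -/
theorem ideal_dual_existsUnique (𝔟 : Ideal (IwasawaAlgebra p)) {c : ℤ_[p]}
    (hc : c ∈ IsLocalRing.maximalIdeal ℤ_[p]) (k : ℕ)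
    (hX : (X - C c : IwasawaAlgebra p) ∈ 𝔟) (hp : (p : IwasawaAlgebra p) ^ k ∈ 𝔟)
    (f : 𝔟 →ₗ[IwasawaAlgebra p] IwasawaAlgebra p) :
    ∃! r : IwasawaAlgebra p, ∀ x : 𝔟, f x = r * (x : IwasawaAlgebra p) := by
  have hι : Function.Injective (𝔟.subtype) := Subtype.val_injective
  have ha : 𝔟.subtype ⟨_, hX⟩ ≠ 0 := by
    simpa using (IwasawaAlgebra.prime_X_sub_C p hc).ne_zero
  have hcop : ∀ y, 𝔟.subtype ⟨_, hX⟩ ∣ 𝔟.subtype ⟨_, hp⟩ * y → 𝔟.subtype ⟨_, hX⟩ ∣ y := by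
    intro y hy
    exact X_sub_C_dvd_of_dvd_natCast_pow_mul p hc k y (by simpa using hy)
  simpa using dual_existsUnique_of_coprimePair 𝔟.subtype hι ha hcop f

/-- The same as a statement about the map `r ↦ r · (inclusion)`: it is a BIJECTION `Λ → Hom_Λ(𝔟, Λ)`,
i.e. `Hom_Λ(𝔟, Λ)` is free of rank one generated by the inclusion (N2′ for such `𝔟`). -/
theorem ideal_dual_generator_bijective (𝔟 : Ideal (IwasawaAlgebra p)) {c : ℤ_[p]}
    (hc : c ∈ IsLocalRing.maximalIdeal ℤ_[p]) (k : ℕ)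
    (hX : (X - C c : IwasawaAlgebra p) ∈ 𝔟) (hp : (p : IwasawaAlgebra p) ^ k ∈ 𝔟) :
    Function.Bijective (fun r : IwasawaAlgebra p => r • 𝔟.subtype) := by
  constructor
  · intro r r' h
    have h1 := congrArg (fun g : 𝔟 →ₗ[IwasawaAlgebra p] IwasawaAlgebra p => g ⟨_, hX⟩) h
    simp only [LinearMap.smul_apply, Submodule.subtype_apply, smul_eq_mul] at h1
    exact mul_right_cancel₀ (IwasawaAlgebra.prime_X_sub_C p hc).ne_zero h1
  · intro f
    obtain ⟨r, hr, -⟩ := ideal_dual_existsUnique p 𝔟 hc k hX hp f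
    refine ⟨r, ?_⟩
    ext x
    simp [hr x]

/-- Special case `𝔟 = 𝔪 = (p, T)`: the maximal ideal of `Λ` has free dual of rank one. -/
theorem maximalIdeal_span_dual_generator_bijective :
    Function.Bijective (fun r : IwasawaAlgebra p =>
      r • (Ideal.span ({(p : IwasawaAlgebra p), X} : Set (IwasawaAlgebra p))).subtype) := by
  have hc : (0 : ℤ_[p]) ∈ IsLocalRing.maximalIdeal ℤ_[p] := Submodule.zero_mem _
  have hX : (X - C (0 : ℤ_[p]) : IwasawaAlgebra p) ∈
      Ideal.span ({(p : IwasawaAlgebra p), X} : Set (IwasawaAlgebra p)) := by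
    rw [map_zero, sub_zero]
    exact Ideal.subset_span (by simp)
  have hp : (p : IwasawaAlgebra p) ^ 1 ∈
      Ideal.span ({(p : IwasawaAlgebra p), X} : Set (IwasawaAlgebra p)) := by
    rw [pow_one]
    exact Ideal.subset_span (by simp)
  exact ideal_dual_generator_bijective p _ hc 1 hX hp

end Iwasawa

/-! ### §3 The typed dictionary of the six split-bad keys (decidable tables)

`u` = square class at `v` of the ramified quadratic character `χ_u = χ_{d,v}` (`u ∈ {-1,3}` ↔ `d ≡ 3 (4)`,
`u ∈ {±2, ±6}` ↔ `d` even).  `L = ℚ₂(√u)`, `𝒪_L = ℤ₂[√u]` (all six `u ≢ 1 (4)`), elements `a + b√u`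
modelled EXACTLY in `ℤ × ℤ`; `v_L ≥ 4 ⟺ ∈ 4𝒪_L ⟺ 4 ∣ a ∧ 4 ∣ b` (`e(L/ℚ₂) = 2`). -/

section Dictionary

/-- The six keys. -/
def keys : List ℤ := [-1, 3, 2, -2, 6, -6]

/-- `a + b√u ∈ ℤ[√u]`. -/
structure O2 where
  a : ℤ
  b : ℤ
deriving DecidableEq, Repr

/-- Multiplication in `ℤ[√u]`. -/
def O2.mul (u : ℤ) (z w : O2) : O2 := ⟨z.a * w.a + u * z.b * w.b, z.a * w.b + z.b * w.a⟩

/-- A uniformiser of `ℚ₂(√u)`: `1 + √u` for odd `u`, `√u` for even `u`. -/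
def unif (u : ℤ) : O2 := if u % 2 = 0 then ⟨0, 1⟩ else ⟨1, 1⟩

/-- Norm `a² - u b²`. -/
def O2.norm (u : ℤ) (z : O2) : ℤ := z.a ^ 2 - u * z.b ^ 2

/-- `unif u` IS a uniformiser: its norm has `2`-adic valuation exactly `1`. -/
theorem unif_norm_val_one : ∀ u ∈ keys, (O2.norm u (unif u)) % 2 = 0 ∧ (O2.norm u (unif u)) % 4 ≠ 0 := by
  decide

/-- The Artin–Schreier class `ē(u) ∈ 𝔽₂` of the norm torus: with `π = unif u`, `ε = π²/2`,
`ē(u) = ((ε - 1)/π mod π)`, i.e. `ē(u) = 1 ⟺ v_L(π² - 2 - 2π) ≥ 4 ⟺ π² - 2 - 2π ∈ 4𝒪_L`.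
It is the reduction mod `2` (up to units) of the extension class `y_u` in
`0 → Λ_v → M^u → 𝔽₂⟦Γ_v⟧ → 0`:  `ē(u) = 1 ⟹ ȳ_u = γ - 1`, `M^u ≅ 𝔪_v`;  `ē(u) = 0 ⟹ y_u ∈ Λˣ`, `M^u ≅ Λ_v`. -/
def asClass (u : ℤ) : Bool :=
  let π := unif u
  let π2 := O2.mul u π π
  decide (4 ∣ π2.a - 2 - 2 * π.a) && decide (4 ∣ π2.b - 2 * π.b)

/-- Complementary test `ē(u) = 0 ⟺ π² - 2 ∈ 4𝒪_L` (sanity: exactly one of the two holds). -/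
def asClassZero (u : ℤ) : Bool :=
  let π := unif u
  let π2 := O2.mul u π π
  decide (4 ∣ π2.a - 2) && decide (4 ∣ π2.b)

/-- TABLE: `ē(-1) = ē(3) = 1`, `ē(±2) = ē(±6) = 0`; and the two tests are complementary. -/
theorem asClass_table :
    keys.map asClass = [true, true, false, false, false, false] ∧
    ∀ u ∈ keys, asClass u = !asClassZero u := by
  decide

/-- Consistency under the unramified quadratic twist `u ↦ -3u` (`χ_{-3}` is a character of `Γ_v`, the
towers `K_n(√u)` and `K_n(√(-3u))` coincide for `n ≥ 1`, and `Tw_{χ_{-3}}` = `γ ↦ -γ` fixes `𝔪` and freeness):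
the Artin–Schreier bit is constant on `{-1, 3}`, `{2, -6}`, `{-2, 6}` (square classes: `-3·(-1) = 3`,
`-3·2 = -6`, `-3·(-2) = 6`). -/
theorem asClass_twist_invariant :
    asClass (-1) = asClass 3 ∧ asClass 2 = asClass (-6) ∧ asClass (-2) = asClass 6 := by decide

/-- `√u` is a UNIT of `𝒪_L` iff `u` is odd (its norm is `-u`).  Level-0 witness of non-freeness:
for odd `u`, `-1 = √u / σ(√u)` is a quotient `w/σ(w)` of a UNIT, so `-1 ∈ tors` lies in the image of
`U¹(L)/U¹(ℚ₂) ↪ 𝕋_u(ℚ₂)^∧` and the coinvariants `(M^u)_Γ ≅ U¹(L)/U¹(ℚ₂)` are not cyclic. -/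
def sqrtIsUnit (u : ℤ) : Bool := decide (u % 2 ≠ 0)

/-- `-1 · σ(√u) = √u` in `ℤ[√u]` (`σ(√u) = -√u`): the identity behind the level-0 witness. -/
theorem neg_sqrt_conj : ∀ u ∈ keys, O2.mul u ⟨-1, 0⟩ ⟨0, -1⟩ = ⟨0, 1⟩ := by decide

/-- Conductor exponent `n(u)` of `χ_u` (`4` for `u ≡ 3 (4)`, `8` for even `u`) and lower ramification
break `s(u) = n(u) - 1` of `ℚ₂(√u)/ℚ₂` (Serre, *Local Fields* V §3: the Artin–Schreier layer of the norm
map sits at level `t = s(u)`). -/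
def conductorExp (u : ℤ) : ℕ := if u % 2 = 0 then 3 else 2

def lowerBreak (u : ℤ) : ℕ := conductorExp u - 1

/-- DICTIONARY CONSISTENCY (the structural law, checked on all six keys):
`ē(u) = [√u ∈ 𝒪_L^×] = [n(u) = 2] = [s(u) = 1]`. -/
theorem dictionary_consistent :
    ∀ u ∈ keys, asClass u = sqrtIsUnit u ∧ asClass u = decide (conductorExp u = 2) ∧
      asClass u = decide (lowerBreak u = 1) := by
  decide

/-- Hilbert symbols at `2` with the three generators `-1, 5` (inertia `ℤ₂ˣ = ⟨-1⟩ × ⟨5⟩`) and `2`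
(Frobenius): `χ_u(-1) = (-1)^{(u′-1)/2}`, `χ_u(5) = (-1)^{v₂(u)}`, `χ_u(2) = (-1)^{(u′²-1)/8}`, `u = 2^{v₂u}u′`
(Serre, *Cours d'arithmétique* III.1.2). -/
def oddPart (u : ℤ) : ℤ := if u % 2 = 0 then u / 2 else u

def chiNegOne (u : ℤ) : ℤ := if oddPart u % 4 = 1 then 1 else -1

def chiFive (u : ℤ) : ℤ := if u % 2 = 0 then -1 else 1

def chiTwo (u : ℤ) : ℤ := if oddPart u % 8 = 1 ∨ oddPart u % 8 = 7 then 1 else -1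

/-- `2`-adic valuation capped at `3`, with `9` standing for `+∞` (`v₂(0)`); all values met are `≤ 3`. -/
def v2c (n : ℤ) : ℕ :=
  if n = 0 then 9 else if n % 8 = 0 then 3 else if n % 4 = 0 then 2 else if n % 2 = 0 then 1 else 0

/-- `a(u)` = `v₂ gcd(ϑ′(-1) - 1, ϑ′(5) - 1)` for `ϑ′ = χ_cyc χ_u` on INERTIA: the length of de Shalit's
cokernel `𝒟(ϑ′)_{H_v}` = `H₀(H_v, 𝒟(1) ⊗ ρ_v)` ((17) twisted, inertia-coinvariants); written `a(u)` on the card to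
keep `c(u)` for R196″'s cokernel-side digit. -/
def cInertia (u : ℤ) : ℕ := min (v2c (-(chiNegOne u) - 1)) (v2c (5 * chiFive u - 1))

/-- Torsion exponent of `H¹(ℚ₂, T₂𝕋_u) = 𝕋_u(ℚ₂)^∧` (add Frobenius: `ϑ(Frob) = χ_u(2)`):
`= 2` for `u = -1` (`μ₄ ⊂ 𝕋_{-1}`), `= 1` otherwise (`±1`). -/
def torsBare (u : ℤ) : ℕ := min (cInertia u) (v2c (chiTwo u - 1))

/-- Torsion exponent `t(key)` of `H¹(ℚ₂, T(key)_v)` with the unramified twist `ρ^{ur}(Frob) = β`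
(`β` = unit root of the anchor at `v`: for `A = 49a1`, `a₂(A) = 1`, `β^{±1} = (1 ± √-7)/2 ≡ 3 (mod 8)`,
see `unitRoot_mod_eight`; tabulated for `β ≡ 3, 5, 7 (mod 8)` — the digit is keyed by `(u, β mod 8)`). -/
def torsKey (β u : ℤ) : ℕ := min (cInertia u) (v2c (chiTwo u * β - 1))

/-- Predicted colength `ℓ(Λ_v / I_v)` of the module `M(key)_v ≅ I_v` (`1` ↔ `𝔪_v`, `0` ↔ free) = R196″'s
cokernel-side digit `c(u)` of the primitive frame functional `g = Lg_u / 2` (the dual divisibility `j(u)` is `1`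
on every key: `Lg_u(F) = 4Λ_v`, `Lg_u(x) ≡ 2ξ` (even `u`) / `2(ξ - ξ²)` (odd `u`) `mod 4`). -/
def moduleColength (u : ℤ) : ℕ := if asClass u then 1 else 0

/-- Predicted length of the Nekovář descent cokernel `coker(d_v : (M₂)_{H_v} → M_v) = a(u) - ℓ(Λ/I_v)`. -/
def descentCoker (u : ℤ) : ℕ := cInertia u - moduleColength u

/-- Dual divisibility `j(u)` of the frame functional `Lg_u = log(·)/√u` on `M(key)_v`: `1` on every key. -/
def dualDivisibility (_u : ℤ) : ℕ := 1

/-- Layer-0 shadow: `v₂` of the index of `Lg_u(universal norms) ⊂ ℤ₂` at layer `0` = `j(u) + c(u)`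
(`4ℤ₂` for `u ∈ {-1, 3}` — row 85's `log U^{N=1}(ℤ₂[i]) = 4iℤ₂` —, `2ℤ₂` for even `u`; checked numerically
with exact rational arithmetic, 200 terms of `log`, in `tmp/lg_layer0.py`). -/
def layerZeroIndex (u : ℤ) : ℕ := dualDivisibility u + moduleColength u

/-- THE TABLES (keys in the order `-1, 3, 2, -2, 6, -6`). -/
theorem tables :
    keys.map chiNegOne = [-1, -1, 1, -1, -1, 1] ∧
    keys.map chiFive = [1, 1, -1, -1, -1, -1] ∧
    keys.map chiTwo = [1, -1, 1, 1, -1, -1] ∧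
    keys.map conductorExp = [2, 2, 3, 3, 3, 3] ∧
    keys.map cInertia = [2, 2, 1, 1, 1, 1] ∧
    keys.map torsBare = [2, 1, 1, 1, 1, 1] ∧
    keys.map (torsKey 3) = [1, 2, 1, 1, 1, 1] ∧
    keys.map (torsKey 5) = [2, 1, 1, 1, 1, 1] ∧
    keys.map (torsKey 7) = [1, 2, 1, 1, 1, 1] ∧
    keys.map moduleColength = [1, 1, 0, 0, 0, 0] ∧
    keys.map layerZeroIndex = [2, 2, 1, 1, 1, 1] ∧
    keys.map descentCoker = [1, 1, 1, 1, 1, 1] := by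
  decide

/-- LAYER-0 SHADOW, even class (`u = 2`): the norm-one unit `z = 3 + 2√2 = -(1+√2)/(1-√2)` has
`Lg_2(z) = log(z)/√2 = 2·c` with `c = Σ_{k ≥ 0} 2^k/(2k+1)` the `√2`-coefficient of `log(1+√2)`; the terms
`k ≥ 4` lie in `16ℤ₂`, and `105 · Σ_{k<4} 2^k/(2k+1) = 379` is odd, so `c ∈ ℤ₂ˣ` and `v₂(Lg_2 z) = 1`:
the universal-norm lattice at layer 0 is `2ℤ₂` (ONE bit = `j(2)`, colength `c(2) = 0`), not `4ℤ₂`. -/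
theorem layerZero_shadow_even : (105 : ℚ) * (1 + 2 / 3 + 4 / 5 + 8 / 7) = 379 ∧ 379 % 2 = 1 := by
  norm_num

/-- LAYER-0 SHADOW, class `{-1, 3}`, NON-universal norm (`u = 3`): `w = 2 + √3 = 1 + π` (`π = 1 + √3`) is a
norm-one unit NOT of the form `y/σy` with `y ∈ 𝒪_L^×` (it is `(π√3)/σ(π√3)`), and the `√3`-coefficient of
`log w = Σ (-1)^{m+1} π^m/m` (`π^m = A_m + B_m√3`, `B_m = 1, 2, 6, 16, 44, 120, 328, 896, …`) has `v₂ = 1`: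
`35 · Σ_{m ≤ 8} (-1)^{m+1} B_m/m = -2742 = -2·1371` and the tail `m ≥ 9` lies in `4ℤ₂`
(`v₂(B_m) ≥ ⌊m/2⌋`). So `Lg_3(U¹(ℤ₂[√3])^{N=1}) = 2ℤ₂` although `Lg_3(universal norms) = 4ℤ₂ = Lg_{-1}(U¹(ℤ₂[i])^{N=1})`
(row 85): layer-0 lattices must be read on universal norms (the image of `M(key)_v`), not on `H¹(F_0, T(key))`. -/
theorem layerZero_shadow_three_nonUniversal :
    (35 : ℚ) * (1 - 2 / 2 + 6 / 3 - 16 / 4 + 44 / 5 - 120 / 6 + 328 / 7 - 896 / 8) = -2742 ∧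
    (2742 : ℕ) = 2 * 1371 ∧ 1371 % 2 = 1 := by
  norm_num

/-- The binomial `√3`-coefficients used above: `(1 + √3)^m = A_m + B_m √3` in the exact model `ℤ[√3]`
(pairs, `O2.mul 3`). -/
theorem sqrtThree_coeffs :
    (List.range 8).map (fun m => (Nat.iterate (O2.mul 3 ⟨1, 1⟩) (m + 1) ⟨1, 0⟩).b) =
      [1, 2, 6, 16, 44, 120, 328, 896] := by
  decide

/-- The anchor's unit root mod 8 (`49a1`: `a₂ = 1`, Frobenius roots `(1 ± √-7)/2`): for every
`x` with `x² ≡ -7 (mod 64)`, one of `(1 + x)/2`, `(1 - x)/2` is odd and `≡ 3 (mod 8)` (the other is even),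
so `β ≡ 3 (mod 8)` and `β⁻¹ ≡ 3 (mod 8)`; a finite shadow of the `2`-adic statement, by `decide`. -/
theorem unitRoot_mod_eight :
    ∀ x : Fin 64, (x.val * x.val + 7) % 64 = 0 →
      (((x.val + 1) / 2) % 8 = 3 ∧ ((64 + 1 - x.val) / 2) % 2 = 0) ∨
      (((64 + 1 - x.val) / 2) % 8 = 3 ∧ ((x.val + 1) / 2) % 2 = 0) := by
  decide

/-- Product formula sanity for the three symbols restricted to our keys: `χ_u(-1)·χ_u(2)·χ_u(5)`-type
bookkeeping is NOT a product formula; what we check is the genuine identity `χ_u(5) = (-1)^{v₂ u}` versus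
the definition via `(u,5)₂ = (2,5)^{v₂ u}` — i.e. `(u′, 5)₂ = 1` for odd `u′` (both `≡ 1 (4)`-free units). -/
theorem chiFive_eq : ∀ u ∈ keys, chiFive u = (if u % 2 = 0 then -1 else 1) := by decide

end Dictionary

/-! ### §4 Helper-lemma SIGNATURES for the typer (module theory over `Λ = ℤ₂⟦T⟧`; statements only) -/

section Signatures

open PowerSeries Literature.NumberTheory.EllipticCurves

/-- (H-EXT) An extension of `Λ/2` by a free rank-one module inside a torsion-free module is the ideal
`(2, y)`: if `M ⊇ Λ·g` (free), `M = Λx + Λg`, `2x = y·g`, and `a·x ∈ Λg ↔ 2 ∣ a`, then `M ≅ (2, y)`.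
(Used with `g` = generator of `lim U^{(3)}`-part, `x` = lift of the layer-1 normal-basis generator.) -/
def HExt : Prop :=
  ∀ (M : Type) [AddCommGroup M] [Module (IwasawaAlgebra 2) M] [NoZeroSMulDivisors (IwasawaAlgebra 2) M]
    (g x : M) (y : IwasawaAlgebra 2),
    (∀ m : M, ∃ a b : IwasawaAlgebra 2, m = a • x + b • g) →
    (2 : IwasawaAlgebra 2) • x = y • g →
    (∀ a : IwasawaAlgebra 2, (∃ b : IwasawaAlgebra 2, a • x = b • g) ↔ (2 : IwasawaAlgebra 2) ∣ a) →
    Nonempty (M ≃ₗ[IwasawaAlgebra 2] (Ideal.span ({(2 : IwasawaAlgebra 2), y} : Set (IwasawaAlgebra 2))))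

/-- (H-COL) The ideal `(2, y)` of `Λ = ℤ₂⟦T⟧`: it is all of `Λ` iff `y ∉ 𝔪`, and equals `𝔪 = (2, T)` iff
`y ≡ T·(unit) (mod 2)`, i.e. `y ∈ 𝔪` and `coeff₁ y` odd (colength `ord_T(y mod 2)` in general). -/
def HCol : Prop :=
  ∀ y : IwasawaAlgebra 2,
    (Ideal.span ({(2 : IwasawaAlgebra 2), y} : Set (IwasawaAlgebra 2)) = ⊤ ↔
        IsUnit (PowerSeries.constantCoeff y)) ∧
    (Ideal.span ({(2 : IwasawaAlgebra 2), y} : Set (IwasawaAlgebra 2)) =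
        Ideal.span ({(2 : IwasawaAlgebra 2), X} : Set (IwasawaAlgebra 2)) ↔
      (¬ IsUnit (PowerSeries.constantCoeff y) ∧ IsUnit (PowerSeries.coeff 1 y)))

end Signatures

end Summit.BirchSwinnertonDyer.BirchSwinnertonDyer.Cruxes.SplitBadTwoLowerHalfOfFacts.InertiaDescentK2G30
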